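import Summits.CriticalPhenomena.Ising3DConformalLimit.Theorems.InverseSquareTelemetryEtaBoundsFromTelemetry
import HarnessLib

/-!
# Crux `PositiveSolutionAsymptotics` (stmt-CriticalPhenomena-4496), stub `stub_localComparison` (T3):
# the local `(Δ - V)`-harmonic comparison function `H ≈ |x|₂^{-α₊}` on finite sets far out

THEOREM-ONLY file (no definitions, no named facts), `--supports stmt-CriticalPhenomena-4496`.
Let `V : ℤ³ → ℝ` obey `| s V - κ | ≤ C √s^{-ε}` on `{R ≤ √s}` (`s(x) = ∑ᵢ xᵢ² = |x|₂²`, `κ ≥ 0`,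
`ε > 0`), `α₊ = (1 + √(1+4κ))/2 = 2p`. `stub_localComparison` (registered stub T3, verbatim): there
are `S₁` and `η(S) = 2A(S/4)^{-e'} → 0` (`0 ≤ η ≤ 1/2` beyond `S₁`) such that for `S ≥ S₁` and every
FINITE `D ⊆ {s ≥ S}` the Dirichlet problem `Δ_{ℤ³} H = V H` on `D`, `H = √s^{-α₊} = s^{-p}` off `D`,
has a solution with `(1 - η(S)) s^{-p} ≤ H ≤ (1 + η(S)) s^{-p}` on `D`.
* Existence (`exists_latticeLaplacianZd_sub_mul_eq_eq_off_of_hTransform`): `zdDirichletOperator D V`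
  is injective once `Δ - V` has a positive supersolution `h` on `D ∪ ∂D`
  (`zdDirichletOperator_injective_of_hTransform`: the `h`-transform maximum principle
  `subsolution_nonpos_of_hTransform_of_finite` applied to `±` a null vector), hence surjective
  (`LinearMap.injective_iff_surjective`); no sign condition on `V` (for `κ = 0` it may change sign,
  so the tree's `exists_latticeLaplacianZd_sub_mul_eq_eq_off`, `V ≥ 0`, does not apply verbatim).
  Weight `h = s^{-1/4}` (`weight_arith`).
* Bounds (`localComparison_core`): barriers `w± = s^{-p} ∓ A s^{-p-e'}` (`barrier_arith`,
  `latticeLaplacianZd_rpow_neg`), `a = A (S/4)^{-e'} ≤ 1/4`, `∂D ⊆ {s ≥ S/4}`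
  (`sumSq_ge_of_mem_zdOuterBoundary`) so `A s^{-e'} ≤ a` on `D ∪ ∂D`; then `H ≤ w₊/(1-a)`,
  `w₋/(1+a) ≤ H` on `∂D`, hence on `D` (`sub_le_super_of_hTransform`, finite `D`), and
  `(1-2a) s^{-p} ≤ s^{-p}/(1+a) ≤ H ≤ s^{-p}/(1-a) ≤ (1+2a) s^{-p}`.
References: Murata, Duke Math. J. 53 (1986); Keller–Pinchover–Pogorzelski, J. Spectral Theory 10
(2020) §4.2; Lawler, *Intersections of Random Walks* (1991) §1.4 (discrete Dirichlet problem).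
-/

noncomputable section

namespace Summit.CriticalPhenomena.Ising3DConformalLimit.Theorems.PositiveSolutionAsymptotics

open Literature.Probability.LatticeModels Finset Set Filter Topology
open Summit.CriticalPhenomena.Ising3DConformalLimit.Theorems.EtaBoundsFromTelemetry

/-- **The Dirichlet operator of `Δ - V` on a finite set is injective under a positive
supersolution.** If `D ⊆ ℤ^d` is finite (`d ≥ 1`) and `h > 0` on `D ∪ ∂D` satisfies `Δh ≤ V h` on
`D`, then `zdDirichletOperator D V` is injective: a null vector, extended by zero, is a solution of
`Δf = V f` on `D` vanishing on `∂D`, so `f ≤ 0` and `-f ≤ 0` on `D` by the `h`-transform maximum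
principle `subsolution_nonpos_of_hTransform_of_finite`. No sign condition on `V`. [folklore] -/
theorem zdDirichletOperator_injective_of_hTransform {d : ℕ} (hd : 0 < d) {D : Set (Site d)}
    (hD : D.Finite) {V h : Site d → ℝ} (hpos : ∀ x ∈ D ∪ zdOuterBoundary D, 0 < h x)
    (hsuper : ∀ x ∈ D, latticeLaplacianZd h x ≤ V x * h x) :
    Function.Injective (zdDirichletOperator D V) := by
  refine (injective_iff_map_eq_zero _).2 fun u hu => ?_
  have hsol : ∀ x ∈ D,
      latticeLaplacianZd (zdExtendByZero D u) x = V x * zdExtendByZero D u x := by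
    intro x hx
    have h1 := congrArg (fun f : D → ℝ => f ⟨x, hx⟩) hu
    simp only [zdDirichletOperator_apply, Pi.zero_apply] at h1
    rw [zdExtendByZero_of_mem u hx]
    linarith
  have hoff : ∀ y ∈ zdOuterBoundary D, zdExtendByZero D u y = 0 := fun y hy =>
    zdExtendByZero_of_not_mem u hy.1
  have h1 : ∀ x ∈ D, zdExtendByZero D u x ≤ 0 :=
    subsolution_nonpos_of_hTransform_of_finite hd hD hpos hsuper (fun x hx => (hsol x hx).ge)
      fun y hy => (hoff y hy).le
  have h2 : ∀ x ∈ D, (-zdExtendByZero D u) x ≤ 0 :=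
    subsolution_nonpos_of_hTransform_of_finite hd hD hpos hsuper
      (fun x hx => by rw [Pi.neg_apply, latticeLaplacianZd_neg, hsol x hx, mul_neg])
      fun y hy => by rw [Pi.neg_apply, hoff y hy, neg_zero]
  funext ⟨x, hx⟩
  have h3 := h2 x hx
  rw [Pi.neg_apply, neg_nonpos] at h3
  have h4 := le_antisymm (h1 x hx) h3
  rwa [zdExtendByZero_of_mem u hx] at h4

/-- **Existence for the discrete Dirichlet problem for `Δ - V` on a finite set under a positive
supersolution** (`d ≥ 1`): if `h > 0` on `D ∪ ∂D` and `Δh ≤ V h` on the finite set `D`, then for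
every source `ρ` and exterior datum `g` there is `u : ℤ^d → ℝ` with `Δu(x) - V(x) u(x) = ρ(x)` for
`x ∈ D` and `u = g` off `D` (the injective Dirichlet operator of the finite-dimensional space
`D → ℝ` is surjective; Lawler 1991, §1.4, remark after Thm 1.4.5). [folklore] -/
theorem exists_latticeLaplacianZd_sub_mul_eq_eq_off_of_hTransform {d : ℕ} (hd : 0 < d)
    {D : Set (Site d)} (hD : D.Finite) {V h : Site d → ℝ}
    (hpos : ∀ x ∈ D ∪ zdOuterBoundary D, 0 < h x)
    (hsuper : ∀ x ∈ D, latticeLaplacianZd h x ≤ V x * h x) (ρ g : Site d → ℝ) :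
    ∃ u : Site d → ℝ, (∀ x ∈ D, latticeLaplacianZd u x - V x * u x = ρ x) ∧
      ∀ y ∉ D, u y = g y := by
  classical
  haveI : Fintype D := hD.fintype
  -- exterior datum extended by `0` on `D`
  let g₀ : Site d → ℝ := fun x => if x ∈ D then 0 else g x
  have hsurj : Function.Surjective (zdDirichletOperator D V) :=
    LinearMap.injective_iff_surjective.1
      (zdDirichletOperator_injective_of_hTransform hd hD hpos hsuper)
  obtain ⟨u, hu⟩ := hsurj fun x => ρ x - latticeLaplacianZd g₀ x
  refine ⟨zdExtendByZero D u + g₀, fun x hx => ?_, fun y hy => ?_⟩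
  · have h1 := congrArg (fun f : D → ℝ => f ⟨x, hx⟩) hu
    simp only [zdDirichletOperator_apply] at h1
    have hg₀x : g₀ x = 0 := by simp [g₀, hx]
    rw [latticeLaplacianZd_add, Pi.add_apply, zdExtendByZero_of_mem u hx, hg₀x, add_zero]
    linarith
  · simp [g₀, zdExtendByZero_of_not_mem u hy, hy]

/-- The outer boundary of a set `D ⊆ {S ≤ s}` (`S ≥ 16`) lies in `{S/4 ≤ s}`: a neighbour
`y = x ± eᵢ` of `x ∈ D` has `s(y) = s(x) + (1 ± 2xᵢ) ≥ s(x)/4` (`incr_bounds`). [folklore] -/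
theorem sumSq_ge_of_mem_zdOuterBoundary {S : ℝ} (hS : 16 ≤ S) {D : Set (Site 3)}
    (hDS : ∀ x ∈ D, S ≤ ∑ i, ((x i : ℤ) : ℝ) ^ 2) {y : Site 3} (hy : y ∈ zdOuterBoundary D) :
    S / 4 ≤ ∑ i, ((y i : ℤ) : ℝ) ^ 2 := by
  obtain ⟨-, x, hx, i, hxy⟩ := hy
  have hSx : S ≤ ∑ j, ((x j : ℤ) : ℝ) ^ 2 := hDS x hx
  have h16 : (16 : ℝ) ≤ ∑ j, ((x j : ℤ) : ℝ) ^ 2 := hS.trans hSx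
  obtain ⟨⟨h1, -⟩, h2, -⟩ := incr_bounds h16 (sq_apply_le_sumSq x i)
  rcases hxy with rfl | rfl
  · have hadd : (∑ j, (((x + Pi.single i 1 : Site 3) j : ℤ) : ℝ) ^ 2) =
        (∑ j, ((x j : ℤ) : ℝ) ^ 2) + (2 * ((x i : ℤ) : ℝ) + 1) := by
      fin_cases i <;> simp [Fin.sum_univ_three] <;> ring
    rw [hadd]; linarith
  · have hsub : (∑ j, (((x - Pi.single i 1 : Site 3) j : ℤ) : ℝ) ^ 2) =
        (∑ j, ((x j : ℤ) : ℝ) ^ 2) + (1 - 2 * ((x i : ℤ) : ℝ)) := by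
      fin_cases i <;> simp [Fin.sum_univ_three] <;> ring
    rw [hsub]; linarith

/-- **Local `(Δ - V)`-harmonic comparison function, `s`-form.** Let `|s V - κ| ≤ C s^{-e}` on
`{R₀ ≤ s}` (`κ ≥ 0`, `e > 0`, `C ≥ 0`), `p = (1 + √(1+4κ))/4`. There are `S₁, A, e' > 0` with
`A (S/4)^{-e'} ≤ 1/4` for `S ≥ S₁` such that for every `S ≥ S₁` and every finite `D ⊆ {S ≤ s}`
there is `H` with `ΔH = V H` on `D`, `H = s^{-p}` off `D`, and `(1 - 2a) s^{-p} ≤ H ≤ (1 + 2a) s^{-p}`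
on `D`, `a = A(S/4)^{-e'}` (weight `h = s^{-1/4}`, barriers `w₊/(1-a)`, `w₋/(1+a)`,
`sub_le_super_of_hTransform`). [folklore] -/
theorem localComparison_core {κ e C : ℝ} (hκ : 0 ≤ κ) (he : 0 < e) (hC : 0 ≤ C)
    {V : Site 3 → ℝ} {R₀ : ℝ}
    (hT : ∀ x : Site 3, R₀ ≤ ∑ i, ((x i : ℤ) : ℝ) ^ 2 →
      |(∑ i, ((x i : ℤ) : ℝ) ^ 2) * V x - κ| ≤ C * (∑ i, ((x i : ℤ) : ℝ) ^ 2) ^ (-e)) :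
    ∃ S₁ A e' : ℝ, 0 < A ∧ 0 < e' ∧ 0 < S₁ ∧
      (∀ S : ℝ, S₁ ≤ S → A * (S / 4) ^ (-e') ≤ 1 / 4) ∧
      ∀ S : ℝ, S₁ ≤ S → ∀ D : Set (Site 3), D.Finite →
        (∀ x ∈ D, S ≤ ∑ i, ((x i : ℤ) : ℝ) ^ 2) →
        ∃ H : Site 3 → ℝ, (∀ x ∈ D, latticeLaplacianZd H x = V x * H x) ∧
          (∀ y : Site 3, y ∉ D →
            H y = (∑ i, ((y i : ℤ) : ℝ) ^ 2) ^ (-((1 + Real.sqrt (1 + 4 * κ)) / 4))) ∧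
          ∀ x ∈ D, (1 - 2 * A * (S / 4) ^ (-e')) *
              (∑ i, ((x i : ℤ) : ℝ) ^ 2) ^ (-((1 + Real.sqrt (1 + 4 * κ)) / 4)) ≤ H x ∧
            H x ≤ (1 + 2 * A * (S / 4) ^ (-e')) *
              (∑ i, ((x i : ℤ) : ℝ) ^ 2) ^ (-((1 + Real.sqrt (1 + 4 * κ)) / 4)) := by
  obtain ⟨s, hs⟩ : ∃ s : Site 3 → ℝ, ∀ x, s x = ∑ i, ((x i : ℤ) : ℝ) ^ 2 := ⟨_, fun _ => rfl⟩
  simp only [← hs] at hT ⊢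
  set r : ℝ := Real.sqrt (1 + 4 * κ) with hr
  have hr1 : 1 ≤ r := by
    simpa only [Real.sqrt_one] using Real.sqrt_le_sqrt (show (1 : ℝ) ≤ 1 + 4 * κ by linarith)
  have hrr : r ^ 2 = 1 + 4 * κ := Real.sq_sqrt (by linarith)
  set p : ℝ := (1 + r) / 4 with hp
  have hp2 : 1 / 2 ≤ p := by rw [hp]; linarith
  have hp0 : 0 < p := by linarith
  have hκp : 2 * p * (2 * p - 1) = κ := by rw [hp]; linear_combination (1 / 4 : ℝ) * hrr
  set e' : ℝ := min e (1 / 4) / 2 with he'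
  have he'0 : 0 < e' := by rw [he']; positivity
  have he'e : e' < e := by have := min_le_left e (1 / 4); rw [he']; linarith
  have he'4 : e' ≤ 1 / 8 := by have := min_le_right e (1 / 4); rw [he']; linarith
  set B : ℝ := 2 * e' * (4 * p + 2 * e' - 1) with hB
  have hB0 : 0 < B := by
    have : 0 < 4 * p + 2 * e' - 1 := by linarith
    rw [hB]; positivity
  have hκq : 2 * (p + e') * (2 * (p + e') - 1) = κ + B := by rw [hB, ← hκp]; ring
  obtain ⟨Kp, hKp0, hLp⟩ := latticeLaplacianZd_rpow_neg hp0
  obtain ⟨Kq, hKq0, hLq⟩ := latticeLaplacianZd_rpow_neg (show 0 < p + e' by linarith)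
  obtain ⟨Kh, hKh0, hLh⟩ := latticeLaplacianZd_rpow_neg (show (0 : ℝ) < 1 / 4 by norm_num)
  simp only [← hs] at hLp hLq hLh
  simp only [hκq] at hLq
  simp only [hκp] at hLp
  set A : ℝ := 4 * (C + Kp + 1) / B with hA
  have hA0 : 0 < A := by rw [hA]; positivity
  have hAB : A * B = 4 * (C + Kp + 1) := by rw [hA]; field_simp
  have hev : ∀ᶠ t : ℝ in atTop, 16 ≤ t ∧ (A * Kq * t ^ (-(1 / 2 : ℝ)) ≤ 1 ∧
      (C * A * t ^ (-e) ≤ 1 ∧ (Kh * t ^ (-(1 / 2 : ℝ)) ≤ 1 / 8 ∧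
      (C * t ^ (-e) ≤ 1 / 8 ∧ A * t ^ (-e') ≤ 1 / 4)))) :=
    (eventually_ge_atTop 16).and ((eventually_mul_rpow_neg_le (by norm_num) _ one_pos).and
      ((eventually_mul_rpow_neg_le he _ one_pos).and
      ((eventually_mul_rpow_neg_le (by norm_num) _ (by norm_num)).and
      ((eventually_mul_rpow_neg_le he _ (by norm_num)).and
      (eventually_mul_rpow_neg_le he'0 _ (by norm_num))))))
  obtain ⟨S₂, hS₂⟩ := Filter.eventually_atTop.1 hev
  set S₁ : ℝ := 4 * (max S₂ 16 + max R₀ 0) with hS₁def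
  have hm1 : S₂ ≤ max S₂ 16 := le_max_left _ _
  have hm2 : (16 : ℝ) ≤ max S₂ 16 := le_max_right _ _
  have hm3 : R₀ ≤ max R₀ 0 := le_max_left _ _
  have hm4 : (0 : ℝ) ≤ max R₀ 0 := le_max_right _ _
  have hS₁4 : ∀ S : ℝ, S₁ ≤ S → S₂ ≤ S / 4 ∧ 16 ≤ S / 4 ∧ R₀ ≤ S / 4 := fun S hSS => by
    rw [hS₁def] at hSS
    exact ⟨by linarith, by linarith, by linarith⟩
  have hS₁0 : 0 < S₁ := by rw [hS₁def]; linarith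
  clear_value S₁ A B e' p r
  clear hev hS₁def hA hB he' hp hr hrr
  -- admissible points: `s ≥ S/4` with `S ≥ S₁`
  have adm : ∀ S : ℝ, S₁ ≤ S → ∀ x : Site 3, S / 4 ≤ s x → R₀ ≤ s x ∧ 1 ≤ s x ∧ 16 ≤ s x ∧
      A ≤ s x ^ e' ∧ A * s x ^ (-e') ≤ A * (S / 4) ^ (-e') ∧
      A * Kq * s x ^ (-(1 / 2 : ℝ)) ≤ 1 ∧ C * A * s x ^ (-e) ≤ 1 ∧
      Kh * s x ^ (-(1 / 2 : ℝ)) ≤ 1 / 8 ∧ C * s x ^ (-e) ≤ 1 / 8 := by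
    intro S hSS x hx
    obtain ⟨hS2, hS16, hSR⟩ := hS₁4 S hSS
    obtain ⟨h16, h1, h2, h3, h4, h5⟩ := hS₂ (s x) (hS2.trans hx)
    have hs0 : 0 < s x := by linarith
    refine ⟨hSR.trans hx, by linarith, h16, ?_, ?_, h1, h2, h3, h4⟩
    · have hinv : s x ^ (-e') = (s x ^ e')⁻¹ := Real.rpow_neg hs0.le e'
      have hpos : 0 < s x ^ e' := Real.rpow_pos_of_pos hs0 _
      rw [hinv, ← div_eq_mul_inv, div_le_iff₀ hpos] at h5
      linarith
    · exact mul_le_mul_of_nonneg_left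
        (Real.rpow_le_rpow_of_nonpos (by linarith) hx (by linarith)) hA0.le
  have ha4 : ∀ S : ℝ, S₁ ≤ S → A * (S / 4) ^ (-e') ≤ 1 / 4 := fun S hSS =>
    (hS₂ (S / 4) (hS₁4 S hSS).1).2.2.2.2.2
  refine ⟨S₁, A, e', hA0, he'0, hS₁0, ha4, fun S hSS D hD hDS => ?_⟩
  obtain ⟨hS2, hS16, hSR⟩ := hS₁4 S hSS
  set a : ℝ := A * (S / 4) ^ (-e') with ha
  have ha0 : 0 ≤ a := mul_nonneg hA0.le (Real.rpow_nonneg (by linarith) _)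
  have ha4' : a ≤ 1 / 4 := ha4 S hSS
  have h1a : 0 < 1 - a := by linarith
  have h1a' : 0 < 1 + a := by linarith
  -- `D ∪ ∂D ⊆ {S/4 ≤ s}`
  have hDb : ∀ x ∈ D ∪ zdOuterBoundary D, S / 4 ≤ s x := by
    intro x hx
    rcases hx with hx | hx
    · linarith [hDS x hx]
    · have h := sumSq_ge_of_mem_zdOuterBoundary (S := S) (by linarith) (D := D)
        (fun z hz => by rw [← hs]; exact hDS z hz) hx
      rwa [← hs] at h
  -- (1) the weight `h = s^{-1/4}` is a positive supersolution on `D`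
  have hpos : ∀ x ∈ D ∪ zdOuterBoundary D, 0 < (fun y => s y ^ (-(1 / 4 : ℝ))) x := by
    intro x hx
    have : 0 < s x := by linarith [hDb x hx]
    exact Real.rpow_pos_of_pos this _
  have hsuper : ∀ x ∈ D, latticeLaplacianZd (fun y => s y ^ (-(1 / 4 : ℝ))) x ≤
      V x * (fun y => s y ^ (-(1 / 4 : ℝ))) x := by
    intro x hx
    have hx4 : S / 4 ≤ s x := hDb x (Or.inl hx)
    obtain ⟨hxR, hs1, hs16, -, -, -, -, c3, c4⟩ := adm S hSS x hx4
    exact weight_arith hs1 hκ (hLh x hs16) (hT x hxR) (by linarith)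
  -- (2) the barriers on `D`
  have hbar : ∀ x ∈ D,
      latticeLaplacianZd (fun y => s y ^ (-p) - A * s y ^ (-(p + e'))) x ≤
          V x * (s x ^ (-p) - A * s x ^ (-(p + e'))) ∧
        V x * (s x ^ (-p) + A * s x ^ (-(p + e'))) ≤
          latticeLaplacianZd (fun y => s y ^ (-p) + A * s y ^ (-(p + e'))) x := by
    intro x hx
    have hx4 : S / 4 ≤ s x := hDb x (Or.inl hx)
    obtain ⟨hxR, hs1, hs16, hAu, -, c1, c2, -, -⟩ := adm S hSS x hx4
    obtain ⟨hsub, hadd⟩ := latticeLaplacianZd_sub_const_mul (fun y => s y ^ (-p))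
      (fun y => s y ^ (-(p + e'))) A x
    rw [hsub, hadd]
    refine barrier_arith hs1 hA0.le hC hAu (hLp x hs16) (hLq x hs16) (hT x hxR) ?_
    have h1 : s x ^ (e' - 1 / 2) ≤ 1 := Real.rpow_le_one_of_one_le_of_nonpos hs1 (by linarith)
    have h2 : s x ^ (e' - e) ≤ 1 := Real.rpow_le_one_of_one_le_of_nonpos hs1 (by linarith)
    have h3 : Kp * s x ^ (e' - 1 / 2) ≤ Kp := mul_le_of_le_one_right hKp0 h1
    have h4 : C * s x ^ (e' - e) ≤ C := mul_le_of_le_one_right hC h2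
    linarith
  -- (3) existence of the local solution
  obtain ⟨H, hHsol, hHoff⟩ := exists_latticeLaplacianZd_sub_mul_eq_eq_off_of_hTransform
    (d := 3) (by norm_num) hD hpos hsuper (0 : Site 3 → ℝ) (fun y => s y ^ (-p))
  have hHeq : ∀ x ∈ D, latticeLaplacianZd H x = V x * H x := fun x hx => by
    have h := hHsol x hx
    rw [Pi.zero_apply, sub_eq_zero] at h
    exact h
  -- the boundary inequalities `A s^{-e'} ≤ a` on `∂D`
  have hbdry : ∀ y ∈ zdOuterBoundary D,
      (1 - a) * s y ^ (-p) ≤ s y ^ (-p) - A * s y ^ (-(p + e')) ∧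
        s y ^ (-p) + A * s y ^ (-(p + e')) ≤ (1 + a) * s y ^ (-p) := by
    intro y hy
    have hy4 : S / 4 ≤ s y := hDb y (Or.inr hy)
    obtain ⟨-, hs1, -, -, hAa, -⟩ := adm S hSS y hy4
    rw [← ha] at hAa
    have hs0 : 0 < s y := by linarith
    have h0 : 0 < s y ^ (-p) := Real.rpow_pos_of_pos hs0 _
    have hsplit : s y ^ (-(p + e')) = s y ^ (-e') * s y ^ (-p) := by
      rw [← Real.rpow_add hs0]; congr 1; ring
    have hm : A * s y ^ (-e') * s y ^ (-p) ≤ a * s y ^ (-p) :=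
      mul_le_mul_of_nonneg_right hAa h0.le
    rw [hsplit]
    constructor <;> linarith
  -- (4a) upper bound: `H ≤ w₊/(1-a)` on `D`
  have hupper : ∀ x ∈ D, H x ≤ (1 - a)⁻¹ * (s x ^ (-p) - A * s x ^ (-(p + e'))) := by
    refine sub_le_super_of_hTransform (d := 3) (by norm_num) (E := D) (V := V) (u := H)
      (w := fun y => (1 - a)⁻¹ * (s y ^ (-p) - A * s y ^ (-(p + e'))))
      (h := fun y => s y ^ (-(1 / 4 : ℝ))) hpos hsuper ?_ ?_ ?_ ?_
    · intro x hx
      rw [hHeq x hx]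
    · intro x hx
      rw [latticeLaplacianZd_const_mul]
      have h := (hbar x hx).1
      calc (1 - a)⁻¹ * latticeLaplacianZd (fun y => s y ^ (-p) - A * s y ^ (-(p + e'))) x
          ≤ (1 - a)⁻¹ * (V x * (s x ^ (-p) - A * s x ^ (-(p + e')))) :=
            mul_le_mul_of_nonneg_left h (inv_nonneg.2 h1a.le)
        _ = V x * ((1 - a)⁻¹ * (s x ^ (-p) - A * s x ^ (-(p + e')))) := by ring
    · intro y hy
      show H y ≤ (1 - a)⁻¹ * (s y ^ (-p) - A * s y ^ (-(p + e')))
      rw [hHoff y hy.1, le_inv_mul_iff₀ h1a]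
      exact (hbdry y hy).1
    · intro ε hε
      exact (show ∀ᶠ x in cofinite, x ∉ D from hD.compl_mem_cofinite).mono
        fun _ hx hxD => (hx hxD).elim
  -- (4b) lower bound: `w₋/(1+a) ≤ H` on `D`
  have hlower : ∀ x ∈ D, (1 + a)⁻¹ * (s x ^ (-p) + A * s x ^ (-(p + e'))) ≤ H x := by
    refine sub_le_super_of_hTransform (d := 3) (by norm_num) (E := D) (V := V)
      (u := fun y => (1 + a)⁻¹ * (s y ^ (-p) + A * s y ^ (-(p + e')))) (w := H)
      (h := fun y => s y ^ (-(1 / 4 : ℝ))) hpos hsuper ?_ ?_ ?_ ?_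
    · intro x hx
      rw [latticeLaplacianZd_const_mul]
      have h := (hbar x hx).2
      calc V x * ((1 + a)⁻¹ * (s x ^ (-p) + A * s x ^ (-(p + e'))))
          = (1 + a)⁻¹ * (V x * (s x ^ (-p) + A * s x ^ (-(p + e')))) := by ring
        _ ≤ (1 + a)⁻¹ * latticeLaplacianZd (fun y => s y ^ (-p) + A * s y ^ (-(p + e'))) x :=
            mul_le_mul_of_nonneg_left h (inv_nonneg.2 h1a'.le)
    · intro x hx
      rw [hHeq x hx]
    · intro y hy
      show (1 + a)⁻¹ * (s y ^ (-p) + A * s y ^ (-(p + e'))) ≤ H y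
      rw [hHoff y hy.1, inv_mul_le_iff₀ h1a']
      exact (hbdry y hy).2
    · intro ε hε
      exact (show ∀ᶠ x in cofinite, x ∉ D from hD.compl_mem_cofinite).mono
        fun _ hx hxD => (hx hxD).elim
  -- (5) assembly
  have h2a : 2 * A * (S / 4) ^ (-e') = 2 * a := by rw [ha]; ring
  refine ⟨H, hHeq, hHoff, fun x hx => ?_⟩
  rw [h2a]
  have hx4 : S / 4 ≤ s x := hDb x (Or.inl hx)
  obtain ⟨-, hs1, -⟩ := adm S hSS x hx4
  have hs0 : 0 < s x := by linarith
  have h0 : 0 < s x ^ (-p) := Real.rpow_pos_of_pos hs0 _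
  have hq0 : 0 ≤ A * s x ^ (-(p + e')) := mul_nonneg hA0.le (Real.rpow_nonneg hs0.le _)
  constructor
  · have hinv : 1 - 2 * a ≤ (1 + a)⁻¹ := by
      rw [inv_eq_one_div, le_div_iff₀ h1a']
      have haa : 0 ≤ a * a := mul_nonneg ha0 ha0
      linarith
    calc (1 - 2 * a) * s x ^ (-p) ≤ (1 + a)⁻¹ * s x ^ (-p) :=
          mul_le_mul_of_nonneg_right hinv h0.le
      _ ≤ (1 + a)⁻¹ * (s x ^ (-p) + A * s x ^ (-(p + e'))) :=
          mul_le_mul_of_nonneg_left (by linarith) (inv_nonneg.2 h1a'.le)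
      _ ≤ H x := hlower x hx
  · have hinv : (1 - a)⁻¹ ≤ 1 + 2 * a := by
      rw [inv_eq_one_div, div_le_iff₀ h1a]
      have haa : 0 ≤ a * (1 / 4 - a) := mul_nonneg ha0 (by linarith)
      linarith
    calc H x ≤ (1 - a)⁻¹ * (s x ^ (-p) - A * s x ^ (-(p + e'))) := hupper x hx
      _ ≤ (1 - a)⁻¹ * s x ^ (-p) := mul_le_mul_of_nonneg_left (by linarith) (inv_nonneg.2 h1a.le)
      _ ≤ (1 + 2 * a) * s x ^ (-p) := mul_le_mul_of_nonneg_right hinv h0.le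

/-- **T3 (local harmonic comparison function).** Under the Dini bound alone there are a threshold
`S₁` and a rate `η(S) → 0` such that for every `S ≥ S₁` and every FINITE `D ⊆ {s ≥ S}` the Dirichlet
problem `Δ_{ℤ³}H = V H` on `D`, `H = |x|₂^{-α₊}` off `D`, has a solution with
`(1 - η(S))|x|₂^{-α₊} ≤ H ≤ (1 + η(S))|x|₂^{-α₊}` on `D`: existence by injectivity of the Dirichlet
operator of `Δ - V` under the `h`-transform maximum principle with the positive supersolution
`h = s^{-1/4}` (`weight_arith`; `V` may change sign when `κ = 0`, so `exists_latticeLaplacianZd_sub_mul_eq_eq_off`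
does not apply verbatim — redo `zdDirichletOperator_injective` with `subsolution_nonpos_of_hTransform_of_finite`),
two-sided bound by comparing `H` with `w₊/(1-a)` and `w₋/(1+a)` (`barrier_arith`,
`sub_le_super_of_hTransform` on the finite `D`, `a = sup A s^{-e'} ≤ η/2`). The lead Doob-transforms
`Δ - V` by `H` on lattice balls `D` far out. Size M–L. -/
theorem stub_localComparison :
    ∀ κ ε C : ℝ, 0 ≤ κ → 0 < ε → ∀ (V : Literature.Probability.LatticeModels.Site 3 → ℝ) (R : ℝ), (∀ x : Literature.Probability.LatticeModels.Site 3, R ≤ Real.sqrt (∑ i, ((x i : ℝ)) ^ 2) → |(∑ i, ((x i : ℝ)) ^ 2) * V x - κ| ≤ C * Real.sqrt (∑ i, ((x i : ℝ)) ^ 2) ^ (-ε)) → ∃ (S₁ : ℝ) (η : ℝ → ℝ), Filter.Tendsto η Filter.atTop (nhds 0) ∧ (∀ S : ℝ, S₁ ≤ S → 0 ≤ η S ∧ η S ≤ 1 / 2) ∧ ∀ S : ℝ, S₁ ≤ S → ∀ D : Set (Literature.Probability.LatticeModels.Site 3), D.Finite → (∀ x ∈ D, S ≤ (∑ i, ((x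 i : ℝ)) ^ 2)) → ∃ H : Literature.Probability.LatticeModels.Site 3 → ℝ, (∀ x ∈ D, (∑ i : Fin 3, (H (x + Pi.single i 1) + H (x - Pi.single i 1))) - 6 * H x = V x * H x) ∧ (∀ y : Literature.Probability.LatticeModels.Site 3, y ∉ D → H y = Real.sqrt (∑ i, ((y i : ℝ)) ^ 2) ^ (-((1 + Real.sqrt (1 + 4 * κ)) / 2))) ∧ (∀ x ∈ D, (1 - η S) * Real.sqrt (∑ i, ((x i : ℝ)) ^ 2) ^ (-((1 + Real.sqrt (1 + 4 * κ)) / 2)) ≤ H x ∧ H x ≤ (1 + η S) * Real.sqrt (∑ i, ((x i : ℝ)) ^ 2) ^ (-((1 + Real.sqrt (1 + 4 * κ)) / 2))) := by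
  intro κ ε C hκ hε V R hT
  have hsum0 : ∀ x : Site 3, (0 : ℝ) ≤ ∑ i, ((x i : ℤ) : ℝ) ^ 2 := fun x => by positivity
  -- `√s^{-α₊} = s^{-p}`
  have hconv : ∀ x : Site 3,
      Real.sqrt (∑ i, ((x i : ℤ) : ℝ) ^ 2) ^ (-((1 + Real.sqrt (1 + 4 * κ)) / 2)) =
        (∑ i, ((x i : ℤ) : ℝ) ^ 2) ^ (-((1 + Real.sqrt (1 + 4 * κ)) / 4)) := by
    intro x
    rw [Real.sqrt_eq_rpow, ← Real.rpow_mul (hsum0 x)]; congr 1; ring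
  -- the telemetry in `s`-form on `{(max R 0)² ≤ s}`, with `C ↦ max C 0` and `√s^{-ε} = s^{-ε/2}`
  have hT' : ∀ x : Site 3, (max R 0) ^ 2 ≤ ∑ i, ((x i : ℤ) : ℝ) ^ 2 →
      |(∑ i, ((x i : ℤ) : ℝ) ^ 2) * V x - κ| ≤
        max C 0 * (∑ i, ((x i : ℤ) : ℝ) ^ 2) ^ (-(ε / 2)) := by
    intro x hx
    have hR : R ≤ Real.sqrt (∑ i, ((x i : ℤ) : ℝ) ^ 2) := by
      calc R ≤ max R 0 := le_max_left _ _
        _ = Real.sqrt ((max R 0) ^ 2) := (Real.sqrt_sq (le_max_right _ _)).symm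
        _ ≤ Real.sqrt (∑ i, ((x i : ℤ) : ℝ) ^ 2) := Real.sqrt_le_sqrt hx
    have h := hT x hR
    have e2 : Real.sqrt (∑ i, ((x i : ℤ) : ℝ) ^ 2) ^ (-ε) =
        (∑ i, ((x i : ℤ) : ℝ) ^ 2) ^ (-(ε / 2)) := by
      rw [Real.sqrt_eq_rpow, ← Real.rpow_mul (hsum0 x)]; congr 1; ring
    rw [e2] at h
    exact h.trans (mul_le_mul_of_nonneg_right (le_max_left _ _) (Real.rpow_nonneg (hsum0 x) _))
  obtain ⟨S₁, A, e', hA0, he'0, hS₁0, ha4, hmain⟩ :=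
    localComparison_core hκ (half_pos hε) (le_max_right C 0) hT'
  refine ⟨S₁, fun S => 2 * A * (S / 4) ^ (-e'), ?_, ?_, ?_⟩
  · -- `η → 0`
    have h1 : Tendsto (fun S : ℝ => S / 4) atTop atTop :=
      tendsto_id.atTop_div_const (by norm_num)
    have h2 := ((tendsto_rpow_neg_atTop he'0).comp h1).const_mul (2 * A)
    rw [mul_zero] at h2
    exact h2
  · intro S hS
    have hS4 : 0 < S / 4 := by linarith
    have hq : 0 ≤ (S / 4) ^ (-e') := Real.rpow_nonneg hS4.le _
    have h := ha4 S hS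
    constructor
    · exact mul_nonneg (mul_nonneg zero_le_two hA0.le) hq
    · linarith
  · intro S hS D hD hDS
    obtain ⟨H, hHeq, hHoff, hHb⟩ := hmain S hS D hD hDS
    refine ⟨H, fun x hx => ?_, fun y hy => ?_, fun x hx => ?_⟩
    · rw [← latticeLaplacianZd_three]
      exact hHeq x hx
    · rw [hconv]
      exact hHoff y hy
    · rw [hconv]
      exact hHb x hx

end Summit.CriticalPhenomena.Ising3DConformalLimit.Theorems.PositiveSolutionAsymptotics
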